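import Summits.CriticalPhenomena.PercolationContinuityZ3.Theorems.PercNearOneGluingNoHeavyLowerTailAPLTreeFourPointVariance
import Summits.CriticalPhenomena.PercolationContinuityZ3.Theorems.PercNearOneGluingNoHeavyLowerTailAPLVwTwoLoad
import HarnessLib

/-!
# `NoHeavyLowerTail` (stmt-CriticalPhenomena-4575) — inputs of the FOUR-load (V_w) programme: the kernel four-point tree inequality (T3′)
# in the `(p, τ, m, χ)` coordinates of `threeLoad_vw`, and the Bonferroni cell inequality

Support file (prover prim-ineq-gen-8 gen 52; `--supports stmt-CriticalPhenomena-4575`; memo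
run/shared/lean/prim/prim-ineq-gen-8/FINDING-gen52-THREELOAD-LEAN.md §4).  No definitions, no named facts, no sorries.

`μ = prodBernoulli w` on the pairs of a finite vertex type, apex `s`, `K = C(s)`; `p_v = μ(s↔v)`, `τ_uv = μ(s↔u ∩ s↔v)`,
`τ_uvx = μ(s↔u ∩ s↔v ∩ s↔x)`, `m_uv = μ(u↔v ∩ (s↔u)ᶜ)` (`u, v` joined off `K`), `χ_u = χ_{u;vx} = μ(s↔u ∩ v↔x ∩ (s↔v)ᶜ)`.
For k loads the expanded (V_w) functional `W − 2|Cov(L,R)|` contains the term `−4Σ_{u<v<x} ℓ_uℓ_vℓ_x·D_uvx`,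
`D_uvx := Σ_{y∈{u,v,x}} (p_y m_zz′ − χ_{y;zz′}) ≥ 0` (memo §4(1)); the three-load proof (`…APLVwThreeLoadPerc.lean`) only uses `D ≥ 0`.
Numerically (memo §4(4)) the 4-load (V_w) inequality is violated under {Harris, off-K, APL-G} but holds (sup 0⁻) once the KERNEL
four-point tree inequality (T3′) `APL.treeFourPoint_all` (gen 40) is added; in these coordinates (T3′) is a lower bound for `D_uvx` by the
triple-membership probability, and the companion combinatorial input is Bonferroni's inequality for the cells.  THIS FILE records both as
kernel lemmas [this work]:
* **`fourLoad_D_lower_T3`** — `τ_uvx + 2p_up_vp_x − (p_uτ_vx + p_vτ_ux + p_xτ_uv) ≤ D_uvx`;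
* `bonferroni3_real` — for a finite measure and sets `A, B, C, D`:
  `μ(A∩B) + μ(A∩C) + μ(A∩D) − μ(A∩B∩C) − μ(A∩B∩D) − μ(A∩C∩D) ≤ μ(A)`;
* **`fourLoad_bonferroni`** — the percolation instance `τ_uv + τ_ux + τ_uy − τ_uvx − τ_uvy − τ_uxy ≤ p_u` (in the sparse regime:
  "`(k−1)τ ≤ p + C(k−1,2)τ₃`", the constraint that caps the pair overlap at `p/(k−1)` when triples are negligible, memo §4(3),(5)).
-/

noncomputable section

namespace Summit.CriticalPhenomena.PercolationContinuityZ3.Theorems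

namespace APL

open MeasureTheory Set Literature.Probability.Percolation Literature.Probability.LatticeModels
open scoped Classical

/-! ### Bonferroni for one event against three -/

/-- **Bonferroni (degree 2) inside an event.**  For a finite measure `μ` and sets `A, B, C, D`:
`μ(A∩B) + μ(A∩C) + μ(A∩D) − μ(A∩B∩C) − μ(A∩B∩D) − μ(A∩C∩D) ≤ μ(A)`. [folklore] -/
theorem bonferroni3_real {Ω : Type*} [MeasurableSpace Ω] (μ : Measure Ω) [IsFiniteMeasure μ] (A B C D : Set Ω)
    (hC : MeasurableSet (A ∩ C)) (hD : MeasurableSet (A ∩ D)) :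
    μ.real (A ∩ B) + μ.real (A ∩ C) + μ.real (A ∩ D)
        - μ.real (A ∩ B ∩ C) - μ.real (A ∩ B ∩ D) - μ.real (A ∩ C ∩ D) ≤ μ.real A := by
  -- inclusion–exclusion for two sets, twice, plus a union bound
  have h1 : μ.real ((A ∩ B) ∪ (A ∩ C)) + μ.real ((A ∩ B) ∩ (A ∩ C)) = μ.real (A ∩ B) + μ.real (A ∩ C) :=
    measureReal_union_add_inter hC
  have h2 : μ.real (((A ∩ B) ∪ (A ∩ C)) ∪ (A ∩ D)) + μ.real (((A ∩ B) ∪ (A ∩ C)) ∩ (A ∩ D))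
      = μ.real ((A ∩ B) ∪ (A ∩ C)) + μ.real (A ∩ D) :=
    measureReal_union_add_inter hD
  have e1 : (A ∩ B) ∩ (A ∩ C) = A ∩ B ∩ C := by ext ω; simp only [mem_inter_iff]; tauto
  have e2 : ((A ∩ B) ∪ (A ∩ C)) ∩ (A ∩ D) = (A ∩ B ∩ D) ∪ (A ∩ C ∩ D) := by
    ext ω; simp only [mem_inter_iff, mem_union]; tauto
  rw [e1] at h1
  rw [e2] at h2
  have h3 : μ.real ((A ∩ B ∩ D) ∪ (A ∩ C ∩ D)) ≤ μ.real (A ∩ B ∩ D) + μ.real (A ∩ C ∩ D) := measureReal_union_le _ _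
  have h4 : μ.real (((A ∩ B) ∪ (A ∩ C)) ∪ (A ∩ D)) ≤ μ.real A :=
    measureReal_mono (by intro ω hω; simp only [mem_inter_iff, mem_union] at hω; tauto)
  linarith

variable {V : Type*} [Fintype V] (w : Sym2 V → unitInterval) (s u v x y : V)

/-- **Bonferroni for the cells of the cluster of `s`**: `τ_uv + τ_ux + τ_uy − τ_uvx − τ_uvy − τ_uxy ≤ p_u`
(`p_u = μ(s↔u)`, `τ_uv = μ(s↔u ∩ s↔v)`, `τ_uvx = μ(s↔u ∩ s↔v ∩ s↔x)`). [folklore] -/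
theorem fourLoad_bonferroni :
    (prodBernoulli w).real ((openConn s u : Set (BondConfig V)) ∩ (openConn s v : Set (BondConfig V)))
        + (prodBernoulli w).real ((openConn s u : Set (BondConfig V)) ∩ (openConn s x : Set (BondConfig V)))
        + (prodBernoulli w).real ((openConn s u : Set (BondConfig V)) ∩ (openConn s y : Set (BondConfig V)))
        - (prodBernoulli w).real ((openConn s u : Set (BondConfig V)) ∩ (openConn s v : Set (BondConfig V)) ∩ (openConn s x : Set (BondConfig V)))
        - (prodBernoulli w).real ((openConn s u : Set (BondConfig V)) ∩ (openConn s v : Set (BondConfig V)) ∩ (openConn s y : Set (BondConfig V)))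
        - (prodBernoulli w).real ((openConn s u : Set (BondConfig V)) ∩ (openConn s x : Set (BondConfig V)) ∩ (openConn s y : Set (BondConfig V)))
      ≤ (prodBernoulli w).real (openConn s u : Set (BondConfig V)) :=
  bonferroni3_real (prodBernoulli w) _ _ _ _ MeasurableSet.of_discrete MeasurableSet.of_discrete

/-! ### (T3′) in the `(p, τ, m, χ)` coordinates -/

/-- **The kernel four-point tree inequality (T3′) in the coordinates of `threeLoad_vw`.**  With `p_v = μ(s↔v)`, `τ_uv = μ(s↔u ∩ s↔v)`,
`τ_uvx = μ(s↔u ∩ s↔v ∩ s↔x)`, `m_uv = μ(u↔v ∩ (s↔u)ᶜ)`, `χ_u = μ(s↔u ∩ v↔x ∩ (s↔v)ᶜ)` etc., `APL.treeFourPoint_all w s u v x` reads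
  `τ_uvx + 2p_up_vp_x − (p_uτ_vx + p_vτ_ux + p_xτ_uv) ≤ D_uvx := (p_um_vx − χ_u) + (p_vm_ux − χ_v) + (p_xm_uv − χ_x)`,
a lower bound for the `4ℓ_uℓ_vℓ_x·D_uvx` term of `2|Cov(L,R)|` (which the three-load theorem only bounds by `0`). [this work] -/
theorem fourLoad_D_lower_T3 :
    (prodBernoulli w).real ((openConn s u : Set (BondConfig V)) ∩ (openConn s v : Set (BondConfig V)) ∩ (openConn s x : Set (BondConfig V)))
        + 2 * (prodBernoulli w).real (openConn s u : Set (BondConfig V)) * (prodBernoulli w).real (openConn s v : Set (BondConfig V))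
          * (prodBernoulli w).real (openConn s x : Set (BondConfig V))
        - ((prodBernoulli w).real (openConn s u : Set (BondConfig V))
              * (prodBernoulli w).real ((openConn s v : Set (BondConfig V)) ∩ (openConn s x : Set (BondConfig V)))
            + (prodBernoulli w).real (openConn s v : Set (BondConfig V))
              * (prodBernoulli w).real ((openConn s u : Set (BondConfig V)) ∩ (openConn s x : Set (BondConfig V)))
            + (prodBernoulli w).real (openConn s x : Set (BondConfig V))
              * (prodBernoulli w).real ((openConn s u : Set (BondConfig V)) ∩ (openConn s v : Set (BondConfig V)))) ≤
      ((prodBernoulli w).real (openConn s u : Set (BondConfig V))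
            * (prodBernoulli w).real ((openConn v x : Set (BondConfig V)) ∩ (openConn s v : Set (BondConfig V))ᶜ)
          - (prodBernoulli w).real ((openConn s u : Set (BondConfig V)) ∩ (openConn v x : Set (BondConfig V))
              ∩ (openConn s v : Set (BondConfig V))ᶜ))
        + ((prodBernoulli w).real (openConn s v : Set (BondConfig V))
            * (prodBernoulli w).real ((openConn u x : Set (BondConfig V)) ∩ (openConn s u : Set (BondConfig V))ᶜ)
          - (prodBernoulli w).real ((openConn s v : Set (BondConfig V)) ∩ (openConn u x : Set (BondConfig V))
              ∩ (openConn s u : Set (BondConfig V))ᶜ))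
        + ((prodBernoulli w).real (openConn s x : Set (BondConfig V))
            * (prodBernoulli w).real ((openConn u v : Set (BondConfig V)) ∩ (openConn s u : Set (BondConfig V))ᶜ)
          - (prodBernoulli w).real ((openConn s x : Set (BondConfig V)) ∩ (openConn u v : Set (BondConfig V))
              ∩ (openConn s u : Set (BondConfig V))ᶜ)) := by
  have h := treeFourPoint_all w s u v x
  rw [real_openConn_eq_tau_add_off w s v x, real_openConn_eq_tau_add_off w s u x, real_openConn_eq_tau_add_off w s u v,
    Set.inter_right_comm (openConn s u : Set (BondConfig V)) ((openConn s v : Set (BondConfig V))ᶜ),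
    Set.inter_right_comm (openConn s v : Set (BondConfig V)) ((openConn s u : Set (BondConfig V))ᶜ),
    Set.inter_right_comm (openConn s x : Set (BondConfig V)) ((openConn s u : Set (BondConfig V))ᶜ)] at h
  linarith

/-! ### The Harris sandwich for `D` (appended, gen 52) -/

/-- **Harris lower bound for `χ`.**  `p_y·μ(z↔z′) ≤ τ_{yzz′} + χ_{y;zz′}`: the increasing events `{s↔y}` and `{z↔z′}` are positively
correlated (`prodBernoulli_harris`) and `μ(s↔y ∩ z↔z′) = μ(s↔y ∩ s↔z ∩ s↔z′) + μ(s↔y ∩ (s↔z)ᶜ ∩ z↔z′)` (`real_conn_inter_conn_split`).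
[this work] -/
theorem fourLoad_harris_chi_lower (z z' : V) :
    (prodBernoulli w).real (openConn s y : Set (BondConfig V)) * (prodBernoulli w).real (openConn z z' : Set (BondConfig V)) ≤
      (prodBernoulli w).real (openConn s y ∩ openConn s z ∩ openConn s z' : Set (BondConfig V))
        + (prodBernoulli w).real (openConn s y ∩ (openConn s z)ᶜ ∩ openConn z z' : Set (BondConfig V)) := by
  have hH := prodBernoulli_harris w (isUpperSet_openConn s y) (isUpperSet_openConn z z')
    MeasurableSet.of_discrete MeasurableSet.of_discrete
  rw [real_conn_inter_conn_split w s y z z'] at hH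
  exact hH

/-- **The Harris sandwich for `D_uvx`** (upper half; the lower half is `fourLoad_D_lower_T3`): summing `fourLoad_harris_chi_lower` over the
three apexes of the triple and using `μ(z↔z′) = τ_zz′ + m_zz′` (`real_openConn_eq_tau_add_off`),
  `D_uvx = Σ_y (p_ym_zz′ − χ_{y;zz′}) ≤ 3τ_uvx − (p_uτ_vx + p_vτ_ux + p_xτ_uv)`,
so together with (T3′): `τ_uvx + 2p_up_vp_x ≤ D_uvx + Σ_y p_yτ_zz′ ≤ 3τ_uvx` — in the sparse regime `D` is pinned between `τ₃` and `3τ₃`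
(memo FINDING-gen52 §4). [this work] -/
theorem fourLoad_D_upper_harris :
    ((prodBernoulli w).real (openConn s u : Set (BondConfig V))
            * (prodBernoulli w).real ((openConn v x : Set (BondConfig V)) ∩ (openConn s v : Set (BondConfig V))ᶜ)
          - (prodBernoulli w).real ((openConn s u : Set (BondConfig V)) ∩ (openConn v x : Set (BondConfig V))
              ∩ (openConn s v : Set (BondConfig V))ᶜ))
        + ((prodBernoulli w).real (openConn s v : Set (BondConfig V))
            * (prodBernoulli w).real ((openConn u x : Set (BondConfig V)) ∩ (openConn s u : Set (BondConfig V))ᶜ)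
          - (prodBernoulli w).real ((openConn s v : Set (BondConfig V)) ∩ (openConn u x : Set (BondConfig V))
              ∩ (openConn s u : Set (BondConfig V))ᶜ))
        + ((prodBernoulli w).real (openConn s x : Set (BondConfig V))
            * (prodBernoulli w).real ((openConn u v : Set (BondConfig V)) ∩ (openConn s u : Set (BondConfig V))ᶜ)
          - (prodBernoulli w).real ((openConn s x : Set (BondConfig V)) ∩ (openConn u v : Set (BondConfig V))
              ∩ (openConn s u : Set (BondConfig V))ᶜ)) ≤
      3 * (prodBernoulli w).real ((openConn s u : Set (BondConfig V)) ∩ (openConn s v : Set (BondConfig V)) ∩ (openConn s x : Set (BondConfig V)))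
        - ((prodBernoulli w).real (openConn s u : Set (BondConfig V))
              * (prodBernoulli w).real ((openConn s v : Set (BondConfig V)) ∩ (openConn s x : Set (BondConfig V)))
            + (prodBernoulli w).real (openConn s v : Set (BondConfig V))
              * (prodBernoulli w).real ((openConn s u : Set (BondConfig V)) ∩ (openConn s x : Set (BondConfig V)))
            + (prodBernoulli w).real (openConn s x : Set (BondConfig V))
              * (prodBernoulli w).real ((openConn s u : Set (BondConfig V)) ∩ (openConn s v : Set (BondConfig V)))) := by
  have h1 := fourLoad_harris_chi_lower w s u v x
  have h2 := fourLoad_harris_chi_lower w s v u x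
  have h3 := fourLoad_harris_chi_lower w s x u v
  rw [real_openConn_eq_tau_add_off w s v x] at h1
  rw [real_openConn_eq_tau_add_off w s u x] at h2
  rw [real_openConn_eq_tau_add_off w s u v] at h3
  rw [Set.inter_right_comm (openConn s u : Set (BondConfig V)) ((openConn s v : Set (BondConfig V))ᶜ)] at h1
  rw [Set.inter_right_comm (openConn s v : Set (BondConfig V)) ((openConn s u : Set (BondConfig V))ᶜ)] at h2
  rw [Set.inter_right_comm (openConn s x : Set (BondConfig V)) ((openConn s u : Set (BondConfig V))ᶜ)] at h3
  have e2 : (openConn s v ∩ openConn s u ∩ openConn s x : Set (BondConfig V))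
      = (openConn s u ∩ openConn s v ∩ openConn s x : Set (BondConfig V)) := by
    rw [Set.inter_comm (openConn s v : Set (BondConfig V)) (openConn s u : Set (BondConfig V))]
  have e3 : (openConn s x ∩ openConn s u ∩ openConn s v : Set (BondConfig V))
      = (openConn s u ∩ openConn s v ∩ openConn s x : Set (BondConfig V)) := by
    rw [Set.inter_comm (openConn s x : Set (BondConfig V)) (openConn s u : Set (BondConfig V)), Set.inter_assoc,
      Set.inter_comm (openConn s x : Set (BondConfig V)) (openConn s v : Set (BondConfig V)), ← Set.inter_assoc]
  rw [e2] at h2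
  rw [e3] at h3
  linarith

end APL

end Summit.CriticalPhenomena.PercolationContinuityZ3.Theorems
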